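import Literature.Barriers.AtomisticToContinuum.AnticontinuumLocalizationCutoffs
import Literature.Barriers.AtomisticToContinuum.AnticontinuumLocalizationWellPosed
import Literature.Barriers.AtomisticToContinuum.AnticontinuumLocalizationDynamics
import HarnessLib

/-!
# De Roeck–Huveneers 2015, §5.1–5.2 for the rotor chain: `H̃_{>a}`, `U_a`, `G_a` and the identity

`Literature/Barriers/AtomisticToContinuum/` — continuation of `AnticontinuumLocalizationCutoffs.lean`.
Given resonance cut-offs `Θ` (the hypothesis structure standing for §4), a bond `(a, a+1)` of the
window (`b`), the radius `n₃` and the scheme of `AnticontinuumLocalizationNormalForm.lean`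
(`n = n₁` stages, generators `genFun`), this file defines the objects of §5.1–5.2 of W. De Roeck,
F. Huveneers, CPAM 68 (2015), arXiv:1305.5127 and PROVES the identity behind Theorem 1:

* `tailP x F` / `headP x F` (`f_{>x} = ∑_{y>x} f_y`, `f_{≤x}`) with `ev f_{>x} + ev f_{≤x} = ev f`;
* `hgtPoly`, `hlePoly` = `H̃_{>a}`, `H̃_{≤a}` of §5.1 componentwise
  (`∑_{x∈B(a,n₃)} ϑ_{a,x} H̃_{>x} + ϑ_* H̃_{>a}`), with `H̃_{≤a} + H̃_{>a} = H̃` (`ev_hgtPoly_add_hlePoly`);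
* their semantic truncated series `hgtTS`, `hleTS` (smooth at scales `δ ∈ (0,1]`), with
  `hgtTS + hleTS = Q_n H` (`hgtTS_add_hleTS`) hence `R hgtTS + R hleTS = H` (`rOp_hgtTS_add`);
* `U₀ = H^O_{>a} - 𝒯(R H̃_{>a})` (`U0`; §5.2: `U_a = H^O_{>a} - H_{>a} - ⟨·⟩_T`), the two terms
  `A = 𝒯(R(H̃ · H̃_{>a}))`, `B = {V, (R H̃_{>a})_n}` and `G₀ = ε^{-(n₀+1)}(A + ε^{n+1}B)` (`G0`);
* `L_H H^O_{>a} = ε J_{a,a+1}` (`liouville_tailEnergy`, first display of §5.2, from the flow) and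
  **`ε J_{a,a+1} = L_H U₀ + (A + ε^{n+1} B)`** (`current_eq_liouville_U0_add`), i.e.
  `ε J = L_H U₀ + ε^{n₀+1} G₀` (`current_identity`) — the algebraic skeleton of Theorem 1 with
  `U = U₀`, `G = G₀`, by the second point of Proposition 1 (`liouville_eval_rOp`).
-/

noncomputable section

open Function Set Finset Filter Metric
open scoped ContDiff BigOperators Topology

namespace Literature.Barriers.AtomisticToContinuum.HeatConduction.RotorChain

open Literature.MathematicalPhysics.KineticTheory.HeatConduction
open Literature.Analysis.Calculus Literature.Analysis.Calculus.IsDeltaSymbol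
open Literature.Algebra.Lie Literature.Algebra.Lie.TruncSeries

variable {m : ℕ}

/-! ### `f_{>x}` and `f_{≤x}` -/

/-- `f_{>x} = ∑_{y > x} f_y`: the terms anchored strictly to the right of `x`. [cite: DeRoeckHuveneers2015, §5.1 (`∑_{y > x} H̃_y` in the definition of `H̃_{>a}`)] -/
def tailP (x : Fin m) (F : TrigPoly m) : TrigPoly m := F.filter fun t => decide (x < t.pos)

/-- `f_{≤x} = ∑_{y ≤ x} f_y`. [cite: DeRoeckHuveneers2015, §5.1 (`∑_{y ≤ x} H̃_y` in the definition of `H̃_{≤a}`)] -/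
def headP (x : Fin m) (F : TrigPoly m) : TrigPoly m := F.filter fun t => !decide (x < t.pos)

/-- Terms of `f_{>x}` are terms of `f` anchored right of `x`. [folklore] -/
theorem mem_tailP {x : Fin m} {F : TrigPoly m} {t : TrigTerm m} : t ∈ tailP x F ↔ t ∈ F ∧ x < t.pos := by
  simp [tailP, List.mem_filter]

/-- Terms of `f_{≤x}` are terms of `f` anchored at or left of `x`. [folklore] -/
theorem mem_headP {x : Fin m} {F : TrigPoly m} {t : TrigTerm m} : t ∈ headP x F ↔ t ∈ F ∧ t.pos ≤ x := by
  simp [headP, List.mem_filter, not_lt]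

/-- `f = f_{>x} + f_{≤x}`. [folklore] -/
theorem ev_tailP_add_headP (x : Fin m) (F : TrigPoly m) (δ : ℝ) (z : PhaseSpace m) :
    TrigPoly.ev (tailP x F) δ z + TrigPoly.ev (headP x F) δ z = TrigPoly.ev F δ z := by
  induction F with
  | nil => simp [tailP, headP, TrigPoly.ev_nil]
  | cons t F ih =>
    simp only [tailP, headP, List.filter_cons] at ih ⊢
    by_cases h : x < t.pos
    · simp only [h, decide_true, Bool.not_true, Bool.false_eq_true, if_false, if_true, TrigPoly.ev_cons]
      linarith
    · simp only [h, decide_false, Bool.not_false, if_true, Bool.false_eq_true, if_false, TrigPoly.ev_cons]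
      linarith

/-- Sublists keep goodness. [folklore] -/
theorem _root_.Literature.MathematicalPhysics.KineticTheory.HeatConduction.TrigPoly.Good.filter
    {F : TrigPoly m} {r : ℕ} {δ : ℝ} (h : F.Good r δ) (p : TrigTerm m → Bool) : TrigPoly.Good (F.filter p) r δ :=
  ⟨fun t ht => h.1 t (List.mem_of_mem_filter ht), fun t ht => h.2 t (List.mem_of_mem_filter ht)⟩

/-- Sublists keep classes. [folklore] -/
theorem _root_.Literature.MathematicalPhysics.KineticTheory.HeatConduction.TrigPoly.InClass.filter
    {F : TrigPoly m} {p' : ℕ} (h : F.InClass p') (p : TrigTerm m → Bool) : TrigPoly.InClass (F.filter p) p' :=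
  fun t ht => h t (List.mem_of_mem_filter ht)

/-- Sublists keep mode bounds. [folklore] -/
theorem _root_.Literature.MathematicalPhysics.KineticTheory.HeatConduction.TrigPoly.ModeBound.filter
    {F : TrigPoly m} {B : ℕ} (h : F.ModeBound B) (p : TrigTerm m → Bool) : TrigPoly.ModeBound (F.filter p) B :=
  fun t ht => h t (List.mem_of_mem_filter ht)

/-- In a window of `m` sites every polynomial with smooth coefficients is good with radius `m`
(site distances are `< m`). [folklore] -/
theorem good_of_smoothAt {F : TrigPoly m} {δ : ℝ} (h : F.SmoothAt δ) {R : ℕ} (hR : m ≤ R) : F.Good R δ := by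
  refine ⟨fun t _ => ⟨fun y hy => ?_, fun δ' => ⟨?_, ?_⟩⟩, h⟩
  · exfalso
    have : Nat.dist t.pos.val y.val < m := by
      have h1 := t.pos.isLt; have h2 := y.isLt
      unfold Nat.dist; omega
    omega
  all_goals
    refine (dependsOn_univ _).mono fun y _ => ?_
    rw [mem_siteBall]
    have h1 := t.pos.isLt; have h2 := y.isLt
    unfold Nat.dist; omega

/-! ### `H̃_{>a}` and `H̃_{≤a}` -/

section Objects

variable {r L n₂ : ℕ} (Θ : ResonanceCutoffs m r L n₂) (b : Fin m) (n₃ : ℕ) (γ : ℝ) (n : ℕ)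

/-- **`H̃_{>a}`**, component `j`: `∑_{x ∈ B(a,n₃)} ϑ_{a,x} H̃^{(j)}_{>x} + ϑ_* H̃^{(j)}_{>a}`.
[cite: DeRoeckHuveneers2015, §5.1 (definition of `H̃_{>a}`)] -/
def hgtPoly (j : ℕ) : TrigPoly m :=
  ((nearSites b n₃).toList.flatMap fun x => TrigPoly.smulFun (vt Θ b n₃ x) (tailP x (normalForm m γ n j))) ++
    TrigPoly.smulFun (vtStar Θ b n₃) (tailP b (normalForm m γ n j))

/-- **`H̃_{≤a} = H̃ - H̃_{>a}`**, component `j`: `∑_x ϑ_{a,x} H̃^{(j)}_{≤x} + ϑ_* H̃^{(j)}_{≤a}`.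
[cite: DeRoeckHuveneers2015, §5.1 (definition of `H̃_{≤a}`; "It holds that `H̃ = H̃_{≤a} + H̃_{>a}`")] -/
def hlePoly (j : ℕ) : TrigPoly m :=
  ((nearSites b n₃).toList.flatMap fun x => TrigPoly.smulFun (vt Θ b n₃ x) (headP x (normalForm m γ n j))) ++
    TrigPoly.smulFun (vtStar Θ b n₃) (headP b (normalForm m γ n j))

variable {Θ b n₃ γ n}

/-- A flat-map over `B(a,n₃).toList` evaluates to the `Finset` sum. [folklore] -/
theorem ev_flatMap_toList (s : Finset (Fin m)) (f : Fin m → TrigPoly m) (δ : ℝ) (z : PhaseSpace m) :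
    TrigPoly.ev (s.toList.flatMap f) δ z = ∑ x ∈ s, TrigPoly.ev (f x) δ z := by
  rw [TrigPoly.ev_flatMap, Finset.sum_map_toList]

/-- **`H̃_{>a} + H̃_{≤a} = H̃`** componentwise (partition of unity). [cite: DeRoeckHuveneers2015, §5.1 ("It holds that `H̃ = H̃_{≤a} + H̃_{>a}`")] -/
theorem ev_hgtPoly_add_hlePoly (j : ℕ) (δ : ℝ) (z : PhaseSpace m) :
    TrigPoly.ev (hgtPoly Θ b n₃ γ n j) δ z + TrigPoly.ev (hlePoly Θ b n₃ γ n j) δ z = TrigPoly.ev (normalForm m γ n j) δ z := by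
  unfold hgtPoly hlePoly
  rw [TrigPoly.ev_append, TrigPoly.ev_append, ev_flatMap_toList, ev_flatMap_toList]
  simp only [TrigPoly.ev_smulFun]
  have hsum : ∑ x ∈ nearSites b n₃, vt Θ b n₃ x δ z.2 * TrigPoly.ev (tailP x (normalForm m γ n j)) δ z +
      vtStar Θ b n₃ δ z.2 * TrigPoly.ev (tailP b (normalForm m γ n j)) δ z +
      (∑ x ∈ nearSites b n₃, vt Θ b n₃ x δ z.2 * TrigPoly.ev (headP x (normalForm m γ n j)) δ z +
        vtStar Θ b n₃ δ z.2 * TrigPoly.ev (headP b (normalForm m γ n j)) δ z) =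
      (∑ x ∈ nearSites b n₃, vt Θ b n₃ x δ z.2 + vtStar Θ b n₃ δ z.2) * TrigPoly.ev (normalForm m γ n j) δ z := by
    rw [add_mul, Finset.sum_mul]
    have e : ∀ x : Fin m, vt Θ b n₃ x δ z.2 * TrigPoly.ev (normalForm m γ n j) δ z =
        vt Θ b n₃ x δ z.2 * TrigPoly.ev (tailP x (normalForm m γ n j)) δ z +
          vt Θ b n₃ x δ z.2 * TrigPoly.ev (headP x (normalForm m γ n j)) δ z := fun x => by
      rw [← mul_add, ev_tailP_add_headP]
    simp only [e, Finset.sum_add_distrib]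
    rw [← ev_tailP_add_headP b (normalForm m γ n j) δ z]
    ring
  rw [hsum, sum_vt_add_vtStar, one_mul]

/-- The working radius: `m + r_n` (at least the window size, so that multipliers are trivially local).
[folklore] -/
def bigRad (m n : ℕ) : ℕ := m + stageRad n n

/-- `H̃^{(j)}` is good with the working radius at every scale. [cite: DeRoeckHuveneers2015, §3.2 Prop. 1 (locality of `H̃^{(k)}`, the relations proved in §3.3)] -/
theorem normalForm_good_bigRad (γ : ℝ) (n : ℕ) (δ : ℝ) {j : ℕ} (hj : j ≤ n) :
    (normalForm m γ n j).Good (bigRad m n) δ :=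
  (stage_good m γ n δ n j hj).mono (Nat.le_add_left _ _)

/-- `H̃_{>a}^{(j)}` is good at scales `δ ∈ (0, 1]`. [cite: DeRoeckHuveneers2015, §5.1] -/
theorem hgtPoly_good {δ : ℝ} (hδ : 0 < δ) (hδ1 : δ ≤ 1) {j : ℕ} (hj : j ≤ n) :
    (hgtPoly Θ b n₃ γ n j).Good (bigRad m n) δ := by
  have hF := normalForm_good_bigRad (m := m) γ n δ hj
  have htriv : ∀ (x : Fin m) (p : TrigTerm m → Bool) (θ : ℝ → (Fin m → ℝ) → ℝ),
      ∀ t ∈ (normalForm m γ n j).filter p, ∀ δ', DependsOn (θ δ') (siteBall t.pos (bigRad m n)) := by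
    intro x p θ t _ δ'
    refine (dependsOn_univ _).mono fun y _ => ?_
    rw [mem_siteBall]
    have h1 := t.pos.isLt; have h2 := y.isLt
    unfold Nat.dist bigRad; omega
  refine (TrigPoly.good_flatMap fun x hx => ?_).append ?_
  · exact (hF.filter _).smulFun (htriv x _ _) (contDiff_vt hδ hδ1 x)
  · exact (hF.filter _).smulFun (htriv b _ _) (contDiff_vtStar hδ hδ1)

/-- `H̃_{≤a}^{(j)}` is good at scales `δ ∈ (0, 1]`. [cite: DeRoeckHuveneers2015, §5.1] -/
theorem hlePoly_good {δ : ℝ} (hδ : 0 < δ) (hδ1 : δ ≤ 1) {j : ℕ} (hj : j ≤ n) :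
    (hlePoly Θ b n₃ γ n j).Good (bigRad m n) δ := by
  have hF := normalForm_good_bigRad (m := m) γ n δ hj
  have htriv : ∀ (x : Fin m) (p : TrigTerm m → Bool) (θ : ℝ → (Fin m → ℝ) → ℝ),
      ∀ t ∈ (normalForm m γ n j).filter p, ∀ δ', DependsOn (θ δ') (siteBall t.pos (bigRad m n)) := by
    intro x p θ t _ δ'
    refine (dependsOn_univ _).mono fun y _ => ?_
    rw [mem_siteBall]
    have h1 := t.pos.isLt; have h2 := y.isLt
    unfold Nat.dist bigRad; omega
  refine (TrigPoly.good_flatMap fun x hx => ?_).append ?_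
  · exact (hF.filter _).smulFun (htriv x _ _) (contDiff_vt hδ hδ1 x)
  · exact (hF.filter _).smulFun (htriv b _ _) (contDiff_vtStar hδ hδ1)

/-- **`H̃_{>a}` as a truncated series of smooth functions** (at scales `δ ∈ (0,1]`; `0` otherwise).
[cite: DeRoeckHuveneers2015, §5.1 (definition of `H̃_{>a}`)] -/
def hgtTS (Θ : ResonanceCutoffs m r L n₂) (b : Fin m) (n₃ : ℕ) (γ : ℝ) (n : ℕ) (δ : ℝ) :
    TruncSeries (SmoothFun m) n :=
  TruncSeries.mk (fun j => if h : (0 < δ ∧ δ ≤ 1) ∧ j ≤ n then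
      SmoothFun.mk (TrigPoly.ev (hgtPoly Θ b n₃ γ n j) δ) (hgtPoly_good h.1.1 h.1.2 h.2).contDiff_ev else 0)
    (fun _ hk => dif_neg fun h => absurd h.2 (not_le.2 hk))

/-- **`H̃_{≤a}` as a truncated series of smooth functions.** [cite: DeRoeckHuveneers2015, §5.1 (definition of `H̃_{≤a}`)] -/
def hleTS (Θ : ResonanceCutoffs m r L n₂) (b : Fin m) (n₃ : ℕ) (γ : ℝ) (n : ℕ) (δ : ℝ) :
    TruncSeries (SmoothFun m) n :=
  TruncSeries.mk (fun j => if h : (0 < δ ∧ δ ≤ 1) ∧ j ≤ n then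
      SmoothFun.mk (TrigPoly.ev (hlePoly Θ b n₃ γ n j) δ) (hlePoly_good h.1.1 h.1.2 h.2).contDiff_ev else 0)
    (fun _ hk => dif_neg fun h => absurd h.2 (not_le.2 hk))

/-- Coefficients of `hgtTS` at a good scale. [folklore] -/
theorem val_hgtTS_coeff {δ : ℝ} (hδ : 0 < δ) (hδ1 : δ ≤ 1) {j : ℕ} (hj : j ≤ n) :
    ((hgtTS Θ b n₃ γ n δ).coeff j).val = TrigPoly.ev (hgtPoly Θ b n₃ γ n j) δ := by
  rw [hgtTS, TruncSeries.coeff_mk, dif_pos ⟨⟨hδ, hδ1⟩, hj⟩, SmoothFun.val_mk]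

/-- Coefficients of `hleTS` at a good scale. [folklore] -/
theorem val_hleTS_coeff {δ : ℝ} (hδ : 0 < δ) (hδ1 : δ ≤ 1) {j : ℕ} (hj : j ≤ n) :
    ((hleTS Θ b n₃ γ n δ).coeff j).val = TrigPoly.ev (hlePoly Θ b n₃ γ n j) δ := by
  rw [hleTS, TruncSeries.coeff_mk, dif_pos ⟨⟨hδ, hδ1⟩, hj⟩, SmoothFun.val_mk]

/-- `hgtPoly` represents `hgtTS`. [folklore] -/
theorem hgt_represents {δ : ℝ} (hδ : 0 < δ) (hδ1 : δ ≤ 1) :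
    SymSeries.Represents δ n (hgtPoly Θ b n₃ γ n) (hgtTS Θ b n₃ γ n δ) :=
  fun _ hj => val_hgtTS_coeff hδ hδ1 hj

/-- `hlePoly` represents `hleTS`. [folklore] -/
theorem hle_represents {δ : ℝ} (hδ : 0 < δ) (hδ1 : δ ≤ 1) :
    SymSeries.Represents δ n (hlePoly Θ b n₃ γ n) (hleTS Θ b n₃ γ n δ) :=
  fun _ hj => val_hleTS_coeff hδ hδ1 hj

/-- **`H̃_{>a} + H̃_{≤a} = H̃ = Q_n H`.** [cite: DeRoeckHuveneers2015, §5.1 ("It holds that `H̃ = H̃_{≤a} + H̃_{>a}`")] -/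
theorem hgtTS_add_hleTS {δ : ℝ} (hδ : 0 < δ) (hδ1 : δ ≤ 1) :
    hgtTS Θ b n₃ γ n δ + hleTS Θ b n₃ γ n δ = TruncSeries.qOp (genFun m γ n δ) n (hamTS m γ n) := by
  ext j : 1
  by_cases hj : j ≤ n
  · apply SmoothFun.ext
    rw [TruncSeries.coeff_add, SmoothFun.val_add, val_hgtTS_coeff hδ hδ1 hj, val_hleTS_coeff hδ hδ1 hj,
      normalForm_represents m γ n δ j hj]
    funext z
    exact ev_hgtPoly_add_hlePoly j δ z
  · rw [TruncSeries.coeff_eq_zero _ (not_le.1 hj), TruncSeries.coeff_eq_zero _ (not_le.1 hj)]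

/-- **`R H̃_{>a} + R H̃_{≤a} = H`** (`R` additive, `R Q H = H`): `H_{>a} + H_{≤a} = H`.
[cite: DeRoeckHuveneers2015, §5.1 ("we finally define a new decomposition `H = H_{≤a} + H_{>a} = 𝒯_{n₁}(R H̃_{≤a}) + 𝒯_{n₁}(R H̃_{>a})`")] -/
theorem rOp_hgtTS_add {δ : ℝ} (hδ : 0 < δ) (hδ1 : δ ≤ 1) :
    TruncSeries.rOp (genFun m γ n δ) n (hgtTS Θ b n₃ γ n δ) + TruncSeries.rOp (genFun m γ n δ) n (hleTS Θ b n₃ γ n δ) =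
      hamTS m γ n := by
  rw [← TruncSeries.rOp_add, hgtTS_add_hleTS hδ hδ1, rOp_qOp_hamTS]

/-! ### `U₀`, `A`, `B`, `G₀` -/

/-- **`U₀ = H^O_{>a} - 𝒯_n(R H̃_{>a})`** (`U_a` before subtracting the mean).
[cite: DeRoeckHuveneers2015, §5.2 (definition of `U_a = H^O_{>a} - H_{>a} - ⟨H^O_{>a} - H_{>a}⟩_T`)] -/
def U0 (Θ : ResonanceCutoffs m r L n₂) (b : Fin m) (n₃ : ℕ) (γ : ℝ) (n : ℕ) (ε δ : ℝ) (z : PhaseSpace m) : ℝ :=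
  tailEnergy m ε γ (b.val + 1) z -
    (TruncSeries.eval ε (TruncSeries.rOp (genFun m γ n δ) n (hgtTS Θ b n₃ γ n δ))).val z

/-- **The resonant term `A = 𝒯_n(R(H̃ · H̃_{>a}))`** (the term `𝒯_{n₁}(R L_H̃ H̃_{>a})` of `ε^{n₀+1} G_a`).
[cite: DeRoeckHuveneers2015, §5.2 (definition of `G_a`)] -/
def Aterm (Θ : ResonanceCutoffs m r L n₂) (b : Fin m) (n₃ : ℕ) (γ : ℝ) (n : ℕ) (ε δ : ℝ) (z : PhaseSpace m) : ℝ :=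
  (TruncSeries.eval ε (TruncSeries.rOp (genFun m γ n δ) n
      (TruncSeries.qOp (genFun m γ n δ) n (hamTS m γ n) * hgtTS Θ b n₃ γ n δ))).val z

/-- **The truncation term `B = {V, (R H̃_{>a})_n}`** (the term `ε^{n₁+1} L_V ∑_k R^{(n₁-k)} H̃^{(k)}_{>a}` of `ε^{n₀+1} G_a`, up to the power of `ε`).
[cite: DeRoeckHuveneers2015, §5.2 (definition of `G_a`)] -/
def Bterm (Θ : ResonanceCutoffs m r L n₂) (b : Fin m) (n₃ : ℕ) (γ : ℝ) (n : ℕ) (δ : ℝ) (z : PhaseSpace m) : ℝ :=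
  poisson (potentialEnergy m γ) ((TruncSeries.rOp (genFun m γ n δ) n (hgtTS Θ b n₃ γ n δ)).coeff n).val z

/-- **`G₀ = ε^{-(n₀+1)} (A + ε^{n+1} B)`** (the function `G_a`).
[cite: DeRoeckHuveneers2015, §5.2 (definition of `G_a`: `ε^{n₀+1} G_a = 𝒯_{n₁}(R L_H̃ H̃_{>a}) + ε^{n₁+1} L_V ∑_{k=0}^{n₁} R^{(n₁-k)} H̃^{(k)}_{>a}`)] -/
def G0 (Θ : ResonanceCutoffs m r L n₂) (b : Fin m) (n₃ : ℕ) (γ : ℝ) (n₀ n : ℕ) (ε δ : ℝ) (z : PhaseSpace m) : ℝ :=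
  (ε ^ (n₀ + 1))⁻¹ * (Aterm Θ b n₃ γ n ε δ z + ε ^ (n + 1) * Bterm Θ b n₃ γ n δ z)

/-! ### `L_H H^O_{>a} = ε J` and the identity -/

/-- The tail energy is smooth. [folklore] -/
theorem contDiff_tailEnergy (m : ℕ) (ε γ : ℝ) (k : ℕ) : ContDiff ℝ ∞ (tailEnergy m ε γ k) := by
  unfold tailEnergy
  refine ContDiff.sum fun x _ => ?_
  by_cases hx : k ≤ x.val
  · simp only [hx, if_true]
    have e : (fun z : PhaseSpace m => siteEnergy m ε γ z x) =
        fun z => TrigPoly.ev [kinTerm x] 0 z + ε * TrigPoly.ev (potTerms γ x) 0 z := by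
      funext z
      rw [ev_potTerms, siteEnergy, TrigPoly.ev_cons, TrigPoly.ev_nil]
      simp [kinTerm, TrigTerm.ev, modePhase]
    rw [e]
    have h1 : TrigPoly.Good [kinTerm (m := m) x] 1 0 := by
      have := hamSeries_good m 0 γ 0 0 le_rfl
      simp only [hamSeries, if_true] at this
      exact ⟨fun t ht => this.1 t (by rw [kinPoly, List.mem_ofFn]; simp at ht; exact ⟨x, ht.symm⟩),
        fun t ht => this.2 t (by rw [kinPoly, List.mem_ofFn]; simp at ht; exact ⟨x, ht.symm⟩)⟩
    have h2 : TrigPoly.Good (potTerms (m := m) γ x) 1 0 := by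
      have := hamSeries_good m 1 γ 0 1 le_rfl
      simp only [hamSeries, one_ne_zero, if_false, if_true] at this
      exact ⟨fun t ht => this.1 t (by rw [potPoly, List.mem_flatMap]; exact ⟨x, List.mem_finRange x, ht⟩),
        fun t ht => this.2 t (by rw [potPoly, List.mem_flatMap]; exact ⟨x, List.mem_finRange x, ht⟩)⟩
    exact h1.contDiff_ev.add (contDiff_const.mul h2.contDiff_ev)
  · simp only [hx, if_false]; exact contDiff_const

/-- **`L_H ∑_{x > a} H_x = ε J_{a,a+1}`** (the definition of the current, read off the flow at `t = 0`).
[cite: DeRoeckHuveneers2015, §5.2 (first display: "`ε J_{a,a+1} = L_H H^O_{>a}`") and §2.2] -/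
theorem liouville_tailEnergy (ε γ : ℝ) (b : Fin m) (z : PhaseSpace m) :
    liouville m ε γ (tailEnergy m ε γ (b.val + 1)) z = ε * bondCurrent m b z := by
  have hΦ := isFlow_rotorFlow m ε γ
  have h1 := hΦ.hasDerivAt_comp ((contDiff_tailEnergy m ε γ (b.val + 1)).differentiable (by simp)) z 0
  have h2 := hΦ.hasDerivAt_tailEnergy (b.val + 1) z 0
  rw [hΦ.2.1 z] at h1 h2
  rw [h1.unique h2, tailCurrent_succ]

/-- The value of a `SmoothFun` truncated series is differentiable. [folklore] -/
theorem differentiable_val (f : SmoothFun m) : Differentiable ℝ f.val := f.differentiable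

/-- **The identity: `ε J_{a,a+1} = L_H U₀ + (A + ε^{n+1} B)`** — from `L_H H^O_{>a} = εJ` and
the second point of Proposition 1 applied to `f = H̃_{>a}`. [cite: DeRoeckHuveneers2015, §5.2 (first display, "applying the second point of Proposition 1")] -/
theorem current_eq_liouville_U0_add {n : ℕ} (hn : 1 ≤ n) (ε γ δ : ℝ) (z : PhaseSpace m) :
    ε * bondCurrent m b z = liouville m ε γ (U0 Θ b n₃ γ n ε δ) z +
      (Aterm Θ b n₃ γ n ε δ z + ε ^ (n + 1) * Bterm Θ b n₃ γ n δ z) := by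
  have hP := liouville_eval_rOp (m := m) hn ε γ δ (hgtTS Θ b n₃ γ n δ) z
  have hT := liouville_tailEnergy (m := m) ε γ b z
  have hsub : liouville m ε γ (U0 Θ b n₃ γ n ε δ) z =
      liouville m ε γ (tailEnergy m ε γ (b.val + 1)) z -
        liouville m ε γ (TruncSeries.eval ε (TruncSeries.rOp (genFun m γ n δ) n (hgtTS Θ b n₃ γ n δ))).val z := by
    unfold U0 liouville
    exact poisson_sub_right _ ((contDiff_tailEnergy m ε γ _).differentiable (by simp)) (differentiable_val _) z
  rw [hsub, hT, hP]
  unfold Aterm Bterm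
  ring

/-- **`ε J = L_H U₀ + ε^{n₀+1} G₀`** (`ε ≠ 0`). [cite: DeRoeckHuveneers2015, §2.3 Thm 1 and §5.2] -/
theorem current_identity {n : ℕ} (hn : 1 ≤ n) (n₀ : ℕ) {ε : ℝ} (hε : ε ≠ 0) (γ δ : ℝ) (z : PhaseSpace m) :
    ε * bondCurrent m b z = liouville m ε γ (U0 Θ b n₃ γ n ε δ) z + ε ^ (n₀ + 1) * G0 Θ b n₃ γ n₀ n ε δ z := by
  rw [current_eq_liouville_U0_add (Θ := Θ) (b := b) (n₃ := n₃) hn ε γ δ z, G0, ← mul_assoc,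
    mul_inv_cancel₀ (pow_ne_zero _ hε), one_mul]

end Objects

end Literature.Barriers.AtomisticToContinuum.HeatConduction.RotorChain

end
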